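import Literature.Computability.Complexity.CircuitComposition
import Literature.Computability.Complexity.NegationElimination
import Literature.Computability.Complexity.NegationLimitedProofs
import Literature.Computability.Complexity.PseudoComplementCircuits
import Mathlib

/-!
# Stub `stub_integerThresholdCircuit` of line `width-threshold-certificate-sparsity` (crux `CliqueExtLowerBound`, stmt-PneNP-10682)

INTEGER THRESHOLDS ARE CHEAP FOR MONOTONE CIRCUITS: `[t ≤ ∑ⱼ wⱼ vⱼ]` with `L`-bit weights on `n` variables has a
`{∧₂, ∨₂, 0, 1}`-circuit with `≤ 60 (n + L + 2)⁴` gates. Everything is PROVED and the file introduces NO definitions: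
the multi-output programs are produced as witnesses of existential statements together with their specifications.

Proof. Put `B = n + L`. If `t ≥ 2^B` the function is constantly `false` (`∑ wⱼ < n 2^L ≤ 2^B`). Otherwise write
`P_b(v) = ∑ⱼ ⌊wⱼ / 2^b⌋ [vⱼ]`, `Q_b = ⌊t / 2^b⌋`, `c_b(v) = ∑ⱼ (⌊wⱼ/2^b⌋ mod 2) [vⱼ]` (the column counts, `≤ n`), so
`P_b = 2 P_{b+1} + c_b`, `Q_b = 2 Q_{b+1} + t_b`, `P_B = Q_B = 0`, `P_0 = ∑ wⱼ [vⱼ]`, `Q_0 = t`. The clamped excess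
`f_b = min (n+2) ((P_b + n + 1) ∸ Q_b) ∈ [0, n+2]` satisfies `f_B = n + 1`, the monotone recursion
`f_b = min (n+2) ((2 f_{b+1} + c_b) ∸ (t_b + n + 1))` (`clamp_step`), and `[t ≤ ∑ wⱼvⱼ] = [n + 1 ≤ f_0]`. The program
carries the unary vectors `[a + 1 ≤ c_b]` (`cktSize_tabT` on the inputs masked by bit `b` of the weights, `≤ 2n² + 1`
gates per entry), the two constants, and `[k + 1 ≤ f_b]` (`k < n + 2`); each entry of level `b` is the monotone OR over
`e ≤ n + 2` of `[e ≤ f_{b+1}] ∧ [k + t_b + n + 2 ≤ 2e + c_b]` (`2 (n + 3) + 1` gates, `exists_level`), top bit down.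
-/

set_option linter.dupNamespace false -- the summit namespace `Summit.PneNP.PneNP.…` repeats `PneNP` by design

open Literature.Computability.Complexity Finset

noncomputable section

namespace Summit.PneNP.PneNP.Theorems.CliqueExtLowerBound.WidthThreshold.ThresholdCircuit

variable {n : ℕ}

/-! ### An OR of ANDs over `{∧₂, ∨₂, 0, 1}` -/

/-- Peeling the last term off an OR of ANDs of selected wires. [folklore] -/
theorem orAnds_succ {ι : Type*} {M : ℕ} (p q : Fin (M + 1) → ι) (y : ι → Bool) :
    decide (∃ e : Fin (M + 1), y (p e) = true ∧ y (q e) = true) =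
      (decide (∃ e : Fin M, y (p e.castSucc) = true ∧ y (q e.castSucc) = true) ||
        (y (p (Fin.last M)) && y (q (Fin.last M)))) := by
  rw [Bool.eq_iff_iff]
  simp only [Bool.or_eq_true, Bool.and_eq_true, decide_eq_true_eq]
  exact Fin.exists_fin_succ'

/-- An OR of `M` ANDs of selected wires, `⋁ₑ (y (p e) ∧ y (q e))`, costs at most `2M + 1` gates
over `{∧₂, ∨₂, 0, 1}`. [folklore] -/
theorem cktSize_orAnds {ι : Type*} : ∀ {M : ℕ} (p q : Fin M → ι),
    CktSize monotoneBasis01 (fun (y : ι → Bool) (_ : Unit) =>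
      decide (∃ e : Fin M, y (p e) = true ∧ y (q e) = true)) (2 * M + 1)
  | 0, p, q => (cktSize_const_mono01 ι false).congr fun y _ => by simp
  | M + 1, p, q => by
    have h1 : CktSize monotoneBasis01 (fun (y : ι → Bool) => Sum.elim y (fun (_ : Unit) =>
        decide (∃ e : Fin M, y (p e.castSucc) = true ∧ y (q e.castSucc) = true)))
        (0 + (2 * M + 1)) :=
      (CktSize.id _).pair (cktSize_orAnds (fun e => p e.castSucc) fun e => q e.castSucc)
    have h2 : CktSize monotoneBasis01 (fun (z : ι ⊕ Unit → Bool) (_ : Unit) =>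
        (z (.inr ()) || (z (.inl (p (Fin.last M))) && z (.inl (q (Fin.last M)))))) 2 :=
      (cktSize_orAnd_mono _ _ _).basis_mono monotoneBasis_subset_monotoneBasis01
    refine ((h1.comp h2).of_le (by omega)).congr fun y _ => ?_
    rw [orAnds_succ]
    simp

/-! ### Column counts -/

/-- `pcount` as a sum of indicator bits. [folklore] -/
theorem pcount_eq_sum (y : Fin n → Bool) :
    ∀ l, l ≤ n → pcount y l = ∑ j : Fin n, if (j : ℕ) < l then (y j).toNat else 0
  | 0, _ => by simp
  | l + 1, hl => by
    rw [pcount_succ y hl, pcount_eq_sum y l (Nat.le_of_succ_le hl)]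
    have key : ∀ j : Fin n, (if (j : ℕ) < l + 1 then (y j).toNat else 0) =
        (if (j : ℕ) < l then (y j).toNat else 0) + (if j = ⟨l, hl⟩ then (y j).toNat else 0) := by
      intro j
      rcases lt_trichotomy (j : ℕ) l with h | h | h
      · simp [h, Fin.ext_iff, h.ne, Nat.lt_succ_of_lt h]
      · subst h
        simp
      · simp [Fin.ext_iff, h.ne', not_lt.2 h.le, not_lt.2 (Nat.succ_le_of_lt h)]
    rw [Finset.sum_congr rfl fun j _ => key j, Finset.sum_add_distrib, Finset.sum_ite_eq']
    simp

/-- `pcount y n` counts all the ones of `y`. [folklore] -/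
theorem pcount_univ (y : Fin n → Bool) : pcount y n = ∑ j : Fin n, (y j).toNat := by
  rw [pcount_eq_sum y n le_rfl]
  exact Finset.sum_congr rfl fun j _ => by simp [j.isLt]

/-- Masking the inputs by bit `b` of the weights (`vⱼ` if `bit_b(wⱼ) = 1`, else `0`) costs one
shared constant gate. [folklore] -/
theorem cktSize_mask (w : Fin n → ℕ) (b : ℕ) : CktSize monotoneBasis01
    (fun (x : Fin n → Bool) (j : Fin n) => if w j / 2 ^ b % 2 = 1 then x j else false) 1 := by
  have h1 : CktSize monotoneBasis01
      (fun (x : Fin n → Bool) => Sum.elim x (fun (_ : Unit) => false)) (0 + 1) :=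
    (CktSize.id _).pair (cktSize_const_mono01 _ false)
  refine (h1.outMap (fun j : Fin n =>
    if w j / 2 ^ b % 2 = 1 then Sum.inl j else Sum.inr ())).congr fun x j => ?_
  split_ifs <;> rfl

/-- The column counts `c_b(v) = ∑ⱼ bit_b(wⱼ) [vⱼ]` are at most `n`. [folklore] -/
theorem cnt_le (w : Fin n → ℕ) (b : ℕ) (x : Fin n → Bool) :
    ∑ j, w j / 2 ^ b % 2 * (if x j then 1 else 0) ≤ n := by
  calc ∑ j, w j / 2 ^ b % 2 * (if x j then 1 else 0) ≤ ∑ _j : Fin n, 1 :=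
        Finset.sum_le_sum fun j _ => by
          have := Nat.mod_lt (w j / 2 ^ b) two_pos
          split_ifs <;> omega
    _ = n := by simp

/-- The column count is the number of ones of the masked input. [folklore] -/
theorem pcount_mask (w : Fin n → ℕ) (b : ℕ) (x : Fin n → Bool) :
    pcount (fun j => if w j / 2 ^ b % 2 = 1 then x j else false) n =
      ∑ j, w j / 2 ^ b % 2 * (if x j then 1 else 0) := by
  rw [pcount_univ]
  refine Finset.sum_congr rfl fun j _ => ?_
  rcases Nat.mod_two_eq_zero_or_one (w j / 2 ^ b) with h | h <;> simp [h]
  cases x j <;> simp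

/-- One unary entry `[a + 1 ≤ c_b(v)]` of a column count, by `cktSize_tabT` on the masked
inputs. [folklore] -/
theorem cktSize_cntBit (w : Fin n → ℕ) (b : ℕ) (a : Fin n) :
    CktSize monotoneBasis01 (fun x (_ : Unit) =>
      decide ((a : ℕ) + 1 ≤ ∑ j, w j / 2 ^ b % 2 * (if x j then 1 else 0))) (2 * n * n + 1) := by
  cases n with
  | zero => exact a.elim0
  | succ m =>
    have h := (cktSize_mask w b).comp
      ((cktSize_tabT (n := m + 1) m (Nat.lt_succ_self m)).basis_mono
        monotoneBasis_subset_monotoneBasis01)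
    refine ((h.outMap fun _ : Unit => Sum.inr ((⟨m, Nat.lt_succ_self m⟩ : Fin (m + 1)), a)).of_le
      (by nlinarith [Nat.zero_le m])).congr fun x _ => ?_
    have ha : min (a : ℕ) m = a := min_eq_left (Nat.lt_succ_iff.mp a.isLt)
    simp only [tabT, Sum.elim_inr, min_self, pthr, ha, pcount_mask]

/-- All unary column-count entries `[a + 1 ≤ c_b(v)]`, `b < B`, `a < n`. [folklore] -/
theorem cktSize_cnts (w : Fin n → ℕ) (B : ℕ) :
    CktSize monotoneBasis01 (fun x (p : Fin B × Fin n) =>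
      decide ((p.2 : ℕ) + 1 ≤ ∑ j, w j / 2 ^ (p.1 : ℕ) % 2 * (if x j then 1 else 0)))
      (B * n * (2 * n * n + 1)) := by
  have := CktSize.pi_const (κ := Fin B × Fin n) (f := fun x (p : Fin B × Fin n) =>
      decide ((p.2 : ℕ) + 1 ≤ ∑ j, w j / 2 ^ (p.1 : ℕ) % 2 * (if x j then 1 else 0)))
    fun p => cktSize_cntBit w p.1 p.2
  rwa [Fintype.card_prod, Fintype.card_fin, Fintype.card_fin] at this

/-! ### Arithmetic of the clamped excess -/

/-- `⌊a / 2^b⌋ = 2 ⌊a / 2^{b+1}⌋ + bit_b(a)`. [folklore] -/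
theorem div_pow_succ (a b : ℕ) : a / 2 ^ b = 2 * (a / 2 ^ (b + 1)) + a / 2 ^ b % 2 := by
  have h := Nat.div_add_mod (a / 2 ^ b) 2
  rw [Nat.div_div_eq_div_mul, ← pow_succ] at h
  exact h.symm

/-- `P_b = 2 P_{b+1} + c_b` for `P_b(v) = ∑ⱼ ⌊wⱼ / 2^b⌋ [vⱼ]`. [folklore] -/
theorem P_succ (w : Fin n → ℕ) (b : ℕ) (x : Fin n → Bool) :
    ∑ j, w j / 2 ^ b * (if x j then 1 else 0) =
      2 * (∑ j, w j / 2 ^ (b + 1) * (if x j then 1 else 0)) +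
        ∑ j, w j / 2 ^ b % 2 * (if x j then 1 else 0) := by
  rw [Finset.mul_sum, ← Finset.sum_add_distrib]
  refine Finset.sum_congr rfl fun j _ => ?_
  have h := div_pow_succ (w j) b
  cases x j
  · simp
  · simpa using h

/-- One level of the clamped excess recursion `f_b = min (n+2) ((2 f_{b+1} + c_b) ∸ (t_b + n + 1))`
for `f_b = min (n+2) ((P_b + n + 1) ∸ Q_b)`, read at the entry `[k + 1 ≤ f_b]`. [folklore] -/
theorem clamp_step {n k P₀ P₁ c q q' r : ℕ} (hP : P₀ = 2 * P₁ + c) (hq : q = 2 * q' + r)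
    (hc : c ≤ n) (hr : r < 2) (hk : k < n + 2) :
    k + r + n + 2 ≤ 2 * min (n + 2) (P₁ + n + 1 - q') + c ↔ k + 1 ≤ min (n + 2) (P₀ + n + 1 - q) := by
  have h1 : min (n + 2) (P₀ + n + 1 - q) =
      min (n + 2) (2 * min (n + 2) (P₁ + n + 1 - q') + c - (r + n + 1)) := by omega
  rw [h1]
  omega

/-! ### One level of the program -/

/-- **One level.** On the wires `(Fin B × Fin n) ⊕ (Bool ⊕ Fin (n + 2))` (unary column counts,
the two constants, the unary clamped excess) there is a `{∧₂, ∨₂, 0, 1}`-program with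
`(n + 2) (2 (n + 3) + 1)` gates that copies the counts and the constants and, whenever its input
carries `[a + 1 ≤ C]` in column `b` and `[k + 1 ≤ f]` in the excess part, outputs
`[k + tb + n + 2 ≤ 2 f + C]` (the OR over `e ≤ n + 2` of `[e ≤ f] ∧ [k + tb + n + 2 - 2e ≤ C]`).
[folklore] -/
theorem exists_level (n B tb : ℕ) (b : Fin B) :
    ∃ G : ((Fin B × Fin n) ⊕ (Bool ⊕ Fin (n + 2)) → Bool) → (Fin B × Fin n) ⊕ (Bool ⊕ Fin (n + 2)) → Bool,
      CktSize monotoneBasis01 G ((n + 2) * (2 * (n + 3) + 1)) ∧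
      (∀ y p, G y (.inl p) = y (.inl p)) ∧ (∀ y c, G y (.inr (.inl c)) = y (.inr (.inl c))) ∧
      ∀ (y : (Fin B × Fin n) ⊕ (Bool ⊕ Fin (n + 2)) → Bool) (C f : ℕ), C ≤ n → f ≤ n + 2 →
        (∀ c, y (.inr (.inl c)) = c) → (∀ a : Fin n, y (.inl (b, a)) = decide ((a : ℕ) + 1 ≤ C)) →
        (∀ k : Fin (n + 2), y (.inr (.inr k)) = decide ((k : ℕ) + 1 ≤ f)) →
        ∀ k : Fin (n + 2), G y (.inr (.inr k)) = decide ((k : ℕ) + tb + n + 2 ≤ 2 * f + C) := by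
  -- the wires `[e ≤ f]` (`e = 0`: the constant `1`) and `[k + tb + n + 2 - 2e ≤ C]`
  let pS : Fin (n + 3) → (Fin B × Fin n) ⊕ (Bool ⊕ Fin (n + 2)) := fun e =>
    if h : (e : ℕ) = 0 then .inr (.inl true) else .inr (.inr ⟨e - 1, by omega⟩)
  let qS : Fin (n + 2) → Fin (n + 3) → (Fin B × Fin n) ⊕ (Bool ⊕ Fin (n + 2)) := fun k e =>
    if h₁ : (k : ℕ) + tb + n + 2 ≤ 2 * e then .inr (.inl true)
    else if h₂ : (k : ℕ) + tb + n + 2 - 2 * e ≤ n then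
      .inl (b, ⟨(k : ℕ) + tb + n + 1 - 2 * e, by omega⟩)
    else .inr (.inl false)
  refine ⟨fun y => Sum.elim (fun p => y (.inl p)) (Sum.elim (fun c => y (.inr (.inl c)))
    fun k => decide (∃ e : Fin (n + 3), y (pS e) = true ∧ y (qS k e) = true)), ?_,
    fun _ _ => rfl, fun _ _ => rfl, ?_⟩
  · have h1 : CktSize monotoneBasis01 (fun (y : (Fin B × Fin n) ⊕ (Bool ⊕ Fin (n + 2)) → Bool) =>
        Sum.elim y (fun k : Fin (n + 2) =>
          decide (∃ e : Fin (n + 3), y (pS e) = true ∧ y (qS k e) = true)))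
        (0 + Fintype.card (Fin (n + 2)) * (2 * (n + 3) + 1)) :=
      (CktSize.id _).pair (CktSize.pi_const
        (f := fun (y : (Fin B × Fin n) ⊕ (Bool ⊕ Fin (n + 2)) → Bool) (k : Fin (n + 2)) =>
          decide (∃ e : Fin (n + 3), y (pS e) = true ∧ y (qS k e) = true))
        fun k => cktSize_orAnds pS (qS k))
    refine ((h1.outMap (Sum.elim (fun p => Sum.inl (Sum.inl p))
      (Sum.elim (fun c => Sum.inl (Sum.inr (Sum.inl c))) fun k => Sum.inr k))).of_le
        (by simp)).congr ?_
    rintro y (p | c | k) <;> rfl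
  · intro y C f hC hf hyc hya hyk k
    have hp : ∀ e : Fin (n + 3), y (pS e) = decide ((e : ℕ) ≤ f) := by
      intro e
      dsimp only [pS]
      split_ifs with h
      · simp [hyc, h]
      · simp only [hyk, decide_eq_decide]
        omega
    have hq : ∀ e : Fin (n + 3), y (qS k e) = decide ((k : ℕ) + tb + n + 2 ≤ 2 * e + C) := by
      intro e
      dsimp only [qS]
      split_ifs with h₁ h₂
      · simp only [hyc, true_eq_decide_iff]; omega
      · simp only [hya, decide_eq_decide]; omega
      · simp only [hyc, false_eq_decide_iff]; omega
    simp only [Sum.elim_inr]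
    rw [decide_eq_decide]
    constructor
    · rintro ⟨e, hpe, hqe⟩
      rw [hp, decide_eq_true_eq] at hpe
      rw [hq, decide_eq_true_eq] at hqe
      omega
    · intro hk
      refine ⟨⟨f, by omega⟩, ?_, ?_⟩
      · rw [hp, decide_eq_true_eq]
      · rw [hq, decide_eq_true_eq]
        dsimp only
        omega

/-! ### All levels, from the top bit down -/

/-- **After `i ≤ B` levels** (bit positions `B - 1, …, B - i`; all weights and `t` below `2^B`):
a program with `B n (2n² + 1) + 2 + i (n + 2) (2 (n + 3) + 1)` gates whose wires carry the unary
column counts `[a + 1 ≤ c_b(v)]`, the two constants, and the unary clamped excess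
`[k + 1 ≤ f_{B-i}(v)]`, `f_b(v) = min (n+2) ((∑ⱼ ⌊wⱼ/2^b⌋[vⱼ] + n + 1) ∸ ⌊t/2^b⌋)`. [folklore] -/
theorem exists_levels (w : Fin n → ℕ) (t B : ℕ) (hw : ∀ j, w j < 2 ^ B) (ht : t < 2 ^ B) :
    ∀ i, i ≤ B → ∃ F : (Fin n → Bool) → (Fin B × Fin n) ⊕ (Bool ⊕ Fin (n + 2)) → Bool,
      CktSize monotoneBasis01 F (B * n * (2 * n * n + 1) + 2 + i * ((n + 2) * (2 * (n + 3) + 1))) ∧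
      ∀ x, (∀ c, F x (.inr (.inl c)) = c) ∧
        (∀ p, F x (.inl p) = decide ((p.2 : ℕ) + 1 ≤ ∑ j, w j / 2 ^ (p.1 : ℕ) % 2 * (if x j then 1 else 0))) ∧
        ∀ k, F x (.inr (.inr k)) = decide ((k : ℕ) + 1 ≤
          min (n + 2) ((∑ j, w j / 2 ^ (B - i) * (if x j then 1 else 0)) + n + 1 - t / 2 ^ (B - i)))
  | 0, _ => by
    refine ⟨fun x => Sum.elim
      (fun p => decide ((p.2 : ℕ) + 1 ≤ ∑ j, w j / 2 ^ (p.1 : ℕ) % 2 * (if x j then 1 else 0)))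
      (Sum.elim (fun c => c) fun k => decide ((k : ℕ) + 1 ≤ n + 1)), ?_,
      fun x => ⟨fun _ => rfl, fun _ => rfl, fun k => ?_⟩⟩
    · have h1 := (cktSize_cnts w B).pair (cktSize_consts_mono01 (Fin n))
      refine ((h1.outMap (Sum.elim (fun p => Sum.inl p) (Sum.elim (fun c => Sum.inr c)
        fun k : Fin (n + 2) => Sum.inr (decide ((k : ℕ) + 1 ≤ n + 1))))).of_le (by simp)).congr ?_
      rintro x (p | c | k) <;> rfl
    · have hP : ∑ j, w j / 2 ^ B * (if x j then 1 else 0) = 0 :=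
        Finset.sum_eq_zero fun j _ => by simp [Nat.div_eq_of_lt (hw j)]
      simp only [Sum.elim_inr, Nat.sub_zero, hP, Nat.div_eq_of_lt ht, decide_eq_decide]
      omega
  | i + 1, hi => by
    obtain ⟨F, hF, hspec⟩ := exists_levels w t B hw ht i (Nat.le_of_succ_le hi)
    have hb : B - (i + 1) < B := by omega
    obtain ⟨G, hG, hGp, hGc, hGk⟩ := exists_level n B (t / 2 ^ (B - (i + 1)) % 2) ⟨B - (i + 1), hb⟩
    refine ⟨fun x => G (F x), (hF.comp hG).of_le (le_of_eq (by ring)), fun x => ?_⟩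
    obtain ⟨hc, hp, hk⟩ := hspec x
    dsimp only
    refine ⟨fun c => by rw [hGc, hc], fun p => by rw [hGp, hp], fun k => ?_⟩
    rw [hGk (F x) (∑ j, w j / 2 ^ (B - (i + 1)) % 2 * (if x j then 1 else 0))
      (min (n + 2) ((∑ j, w j / 2 ^ (B - i) * (if x j then 1 else 0)) + n + 1 - t / 2 ^ (B - i)))
      (cnt_le w _ x) (min_le_left _ _) hc (fun a => hp (⟨B - (i + 1), hb⟩, a)) hk k, decide_eq_decide]
    have hB : B - i = B - (i + 1) + 1 := by omega
    rw [hB]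
    exact clamp_step (P_succ w (B - (i + 1)) x) (div_pow_succ t (B - (i + 1))) (cnt_le w _ x)
      (Nat.mod_lt _ two_pos) k.isLt

/-! ### Assembling the circuit -/

/-- The size bookkeeping: `≤ 60 (n + L + 2)⁴` gates. [folklore] -/
theorem size_bound (n L : ℕ) :
    (n + L) * n * (2 * n * n + 1) + 2 + (n + L) * ((n + 2) * (2 * (n + 3) + 1)) ≤
      60 * (n + L + 2) ^ 4 := by
  set N := n + L + 2 with hN
  have hB : n + L ≤ N := by omega
  have hn : n ≤ N := by omega
  have hn2 : n + 2 ≤ N := by omega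
  have h27 : 2 * (n + 3) + 1 ≤ 4 * N := by omega
  have hsq : 2 * n * n + 1 ≤ 3 * (N * N) := by nlinarith
  have hN2 : 2 ≤ N := by omega
  calc (n + L) * n * (2 * n * n + 1) + 2 + (n + L) * ((n + 2) * (2 * (n + 3) + 1))
      ≤ N * N * (3 * (N * N)) + 2 + N * (N * (4 * N)) := by gcongr
    _ ≤ 60 * N ^ 4 := by nlinarith [Nat.mul_le_mul hN2 (Nat.mul_le_mul hN2 (Nat.mul_le_mul hN2 hN2))]

/-- The weighted sum is below `2^(n+L)`. [folklore] -/
theorem sum_lt_two_pow (L : ℕ) (w : Fin n → ℕ) (hw : ∀ j, w j < 2 ^ L) (x : Fin n → Bool) :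
    ∑ j, w j * (if x j then 1 else 0) < 2 ^ (n + L) := by
  calc ∑ j, w j * (if x j then 1 else 0) ≤ ∑ _j : Fin n, 2 ^ L :=
        Finset.sum_le_sum fun j _ => by
          have := hw j
          split_ifs <;> omega
    _ = n * 2 ^ L := by simp
    _ < 2 ^ n * 2 ^ L := Nat.mul_lt_mul_of_pos_right Nat.lt_two_pow_self (Nat.two_pow_pos L)
    _ = 2 ^ (n + L) := (pow_add 2 n L).symm

/-- STUB `stub_integerThresholdCircuit` of line `width-threshold-certificate-sparsity`: the integer
threshold function `[t ≤ ∑ⱼ wⱼ vⱼ]` with `wⱼ < 2^L` on `n` variables has a monotone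
`{∧₂, ∨₂, 0, 1}`-circuit with at most `60 (n + L + 2)⁴` gates (unary column counts by
`cktSize_tabT` on masked inputs and a clamped carry recursion over the bit positions).
[folklore] -/
theorem stub_integerThresholdCircuit : ∀ (n L : ℕ) (w : Fin n → ℕ) (t : ℕ), (∀ j, w j < 2 ^ L) →
    ∃ Ψ : Circuit (Fin n), Ψ.IsOver monotoneBasis01 ∧ Ψ.size ≤ 60 * (n + L + 2) ^ 4 ∧
      ∀ v : Fin n → Bool, Ψ.eval v = decide (t ≤ ∑ j, w j * (if v j then 1 else 0)) := by
  intro n L w t hw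
  by_cases ht : t < 2 ^ (n + L)
  · have hwB : ∀ j, w j < 2 ^ (n + L) := fun j =>
      (hw j).trans_le (Nat.pow_le_pow_right two_pos (by omega))
    obtain ⟨F, hF, hspec⟩ := exists_levels w t (n + L) hwB ht (n + L) le_rfl
    have h2 := (hF.outMap fun _ : Unit =>
      (Sum.inr (Sum.inr ⟨n, by omega⟩) : (Fin (n + L) × Fin n) ⊕ (Bool ⊕ Fin (n + 2)))).of_le
      (size_bound n L)
    obtain ⟨C, hC, hs, he⟩ := h2.toCircuit
    refine ⟨C, hC, hs, fun v => ?_⟩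
    rw [he, (hspec v).2.2, decide_eq_decide]
    simp only [Nat.sub_self, pow_zero, Nat.div_one]
    omega
  · obtain ⟨C, hC, hs, he⟩ := (cktSize_const_mono01 (Fin n) false).toCircuit
    refine ⟨C, hC, hs.trans ?_, fun v => ?_⟩
    · have : 1 ≤ (n + L + 2) ^ 4 := Nat.one_le_pow _ _ (by omega)
      omega
    · rw [he]
      symm
      rw [decide_eq_false_iff_not, not_le]
      exact (sum_lt_two_pow L w hw v).trans_le (not_lt.mp ht)

end Summit.PneNP.PneNP.Theorems.CliqueExtLowerBound.WidthThreshold.ThresholdCircuit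

end
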